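import Mathlib
import Summits.NavierStokesRegularity.NavierStokesRegularity.Theorems.DssFarFieldSlavingBlowupTypeIDssProfileSimilarityEnstrophyBeltramiLiouville
import Summits.NavierStokesRegularity.NavierStokesRegularity.Theorems.DssFarFieldSlavingBlowupTypeIDssProfileSimilarityEnstrophyCrossFlowThreshold
import Literature.Analysis.FluidPDE.ConstantinDirectionDissipationCalculus
import HarnessLib

/-!
# The CROSS-FLOW threshold WITHOUT the envelope: `√(−t)‖ω × V‖ ≤ θ‖ω‖` with `2θ² < 1` ⇒ `V ≡ 0` for
  EVERY KNSS-gauge Type-I ancient mild field — no (D), no `HasTypeIDecay`, any `C`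
  (pub-ns-dss, route `DssFarFieldSlaving`, crux `BlowupTypeIDssProfile`, stmt-NavierStokesRegularity-0155 —
  SUPPORT; typer seat g20, 2026-08-26; the no-H3 twin of `…SimilarityEnstrophyCrossFlowThreshold`, as
  `…SimilarityEnstrophyTimeOnlyThreshold` (T31⁗) is the no-H3 twin of Row 2′)

HONEST FRAMING. An exclusion statement about a HYPOTHETICAL object (a Type-I ancient mild solution in
the Koch–Nadirashvili–Seregin–Šverák gauge, `IsTypeIAncientMild C V`, ANY constant `C`) under a pointwise
hypothesis nobody asserts; `1/√2` is the threshold of THIS argument (the pointwise inequality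
`|curl Ω|² ≤ 2|∇Ω|²_F` costs a factor `2` against the whole-space div–curl identity used under the envelope,
where the threshold is `1`, `typeI_ancient_eq_zero_of_crossFlow_lt_one`); nothing is said at or above it;
nothing numerical; nothing here bears on Navier–Stokes regularity or blow-up.

THE STATEMENT (`typeI_ancient_eq_zero_of_crossFlow_noDecay`). If `√(−t)·‖ω(t,x) × V(t,x)‖ ≤ θ‖ω(t,x)‖`
for all `t < 0`, `x` (similarity form `‖Ω × U‖ ≤ θ‖Ω‖`: the velocity component across the vorticity is at
most `θ` on the vortex set) and `2θ² < 1`, then `V ≡ 0`. It contains T31⁗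
(`typeI_ancient_eq_zero_of_rate_lt_one`) for `C < 1/√2` only, and neither contains the other.

THE MECHANISM is the cut-off similarity enstrophy of `…CutoffBudget` / `…TimeOnlyThreshold` /
`…BeltramiLiouville` with the stretching term in LAMB FORM against the cut-off
(`two_mul_integral_cutoff_stretching_le_of_crossFlow`): after moving the derivative onto `Ω`
(`integral_mul_inner_stretching_eq`), `⟪U, (Ω·∇)Ω⟫ = ⟪(U·∇)Ω, Ω⟫ − ⟪U, Ω × curl Ω⟫`
(`inner_convect_self_eq_sub`); the first piece is a transport term, `2∫φ⟪(U·∇)Ω, Ω⟫ = −∫(U·∇φ)‖Ω‖²`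
(collar, `‖U‖ ≤ C`); the second is bounded by the cross-flow hypothesis through the scalar triple product
(`inner_lamb_le_of_crossFlow`: `⟪U, Ω × curl Ω⟫ ≤ θ‖Ω‖‖curl Ω‖`) and pointwise Young with
`‖curl Ω‖² ≤ 2|∇Ω|²_F` (`norm_curl_sq_le_two_mul_frobeniusNormSq`): `θ‖Ω‖‖curl Ω‖ ≤ |∇Ω|²_F + (θ²/2)‖Ω‖²`.
Hence `Z_R' ≤ −½(1 − 2θ²)Z_R + (L/R)∫_{B̄_{2R}}‖Ω‖²` (`deriv_cutoffEnstrophy_le_of_crossFlow`), and the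
bootstrap/endgame of `…BeltramiLiouville` (`cutoffEnstrophy_eq_zero_of_budget`,
`eq_zero_of_cutoffEnstrophy_eq_zero`) concludes.
-/

noncomputable section

set_option linter.dupNamespace false

namespace Summit.NavierStokesRegularity.NavierStokesRegularity.Theorems.SimilarityEnstrophy

open MeasureTheory Set Filter Topology Metric InnerProductSpace Function Real
open scoped RealInnerProductSpace Laplacian ContDiff
open Literature.Analysis Literature.Analysis.FluidPDE
open Summit.NavierStokesRegularity.NavierStokesRegularity.Theorems
open Summit.NavierStokesRegularity.NavierStokesRegularity.Theorems.GaussianGap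
open Summit.NavierStokesRegularity.NavierStokesRegularity.Theorems.BlobRiccatiClosure.TypeIApexLiouville

variable {C : ℝ} {V : ℝ → EuclideanSpace ℝ (Fin 3) → EuclideanSpace ℝ (Fin 3)}

/-! ### The cut-off stretching in Lamb form under the cross-flow hypothesis -/

/-- **The stretching term against the cut-off under the cross-flow hypothesis (one slice).** With
`‖U‖ ≤ C` and `‖Ω × U‖ ≤ θ‖Ω‖` pointwise at the slice `s`:
`2∫φ⟪DU Ω, Ω⟫ ≤ 2∫φ‖∇Ω‖²_F + θ²∫φ‖Ω‖² + 3C‖∇φ‖_∞ ∫_{supp φ}‖Ω‖²` — move the derivative onto `Ω`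
(`div Ω = 0`), split `⟪U, (Ω·∇)Ω⟫ = ⟪(U·∇)Ω, Ω⟫ − ⟪U, Ω × curl Ω⟫`, integrate the transport piece by
parts (`div U = 0`), bound the Lamb piece by `θ‖Ω‖‖curl Ω‖ ≤ |∇Ω|²_F + (θ²/2)‖Ω‖²`, and the two collar
terms through `‖Dφ‖ ≤ c₁/R`. [this file; folklore] -/
theorem two_mul_integral_cutoff_stretching_le_of_crossFlow (hV : IsTypeIAncientMild C V) {c₁ : ℝ}
    (hc₁ : ∀ R : ℝ, 0 < R → ∀ y : EuclideanSpace ℝ (Fin 3),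
      ‖fderiv ℝ (fun z : EuclideanSpace ℝ (Fin 3) => smoothTransition (2 - ‖z‖ ^ 2 / R ^ 2)) y‖ ≤
        c₁ / R)
    {θ : ℝ} {s : ℝ}
    (hX : ∀ y : EuclideanSpace ℝ (Fin 3),
      ‖cross (lerayVorticity V s y) (lerayOrbit V s y)‖ ≤ θ * ‖lerayVorticity V s y‖)
    {R : ℝ} (hR : 0 < R) :
    2 * (∫ y, smoothTransition (2 - ‖y‖ ^ 2 / R ^ 2) *
        ⟪fderiv ℝ (lerayOrbit V s) y (lerayVorticity V s y), lerayVorticity V s y⟫) ≤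
      2 * (∫ y, smoothTransition (2 - ‖y‖ ^ 2 / R ^ 2) *
          frobeniusNormSq (fderiv ℝ (lerayVorticity V s) y)) +
        θ ^ 2 * (∫ y, smoothTransition (2 - ‖y‖ ^ 2 / R ^ 2) * ‖lerayVorticity V s y‖ ^ 2) +
        3 * C * (c₁ / R) *
          ∫ y in closedBall (0 : EuclideanSpace ℝ (Fin 3)) (2 * R), ‖lerayVorticity V s y‖ ^ 2 := by
  have hC : 0 ≤ C := hV.nonneg
  set φ : EuclideanSpace ℝ (Fin 3) → ℝ := fun z => smoothTransition (2 - ‖z‖ ^ 2 / R ^ 2)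
    with hφdef
  set Ω := lerayVorticity V s with hΩdef
  set U := lerayOrbit V s with hUdef
  have hφ1 : ContDiff ℝ 1 φ := contDiff_smoothTransition_cutoff (n := 1) R
  have hφ : ContDiff ℝ ∞ φ := contDiff_smoothTransition_cutoff (n := ⊤) R
  have hφc : HasCompactSupport φ := hasCompactSupport_smoothTransition_cutoff hR
  have hφ0 : ∀ y, 0 ≤ φ y := fun y => smoothTransition_cutoff_nonneg R y
  have hΩ1 : ContDiff ℝ 1 Ω := signedBudget_contDiff_lerayVorticity_slice hV s (n := 1)
  have hΩs : ContDiff ℝ ∞ Ω := signedBudget_contDiff_lerayVorticity_slice hV s (n := ⊤)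
  have hU1 : ContDiff ℝ 1 U := mustSqueeze_contDiff_lerayOrbit_slice hV s (n := 1)
  have hUs : ContDiff ℝ ∞ U := mustSqueeze_contDiff_lerayOrbit_slice hV s (n := ⊤)
  have hUC : ∀ y, ‖U y‖ ≤ C := fun y => norm_lerayOrbit_le_of_typeI hV s y
  have hdivΩ : VectorCalculus.IsDivFree Ω := fun y =>
    divergence_curl_eq_zero_holds _
      ((contDiff_lerayOrbit_slice_of_typeI hV s (n := (⊤ : ℕ∞)) le_rfl).of_le (by norm_cast)) y
  have hdivU : VectorCalculus.IsDivFree U :=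
    (isDivFree_lerayOrbit_iff V s).2 (hV.isDivFree (neg_neg_of_pos (Real.exp_pos _)))
  -- continuity
  have hcΩ : Continuous Ω := hΩ1.continuous
  have hcU : Continuous U := hU1.continuous
  have hcDΩ : Continuous (fderiv ℝ Ω) := hΩ1.continuous_fderiv one_ne_zero
  have hcφ : Continuous φ := hφ1.continuous
  have hcDφ : Continuous (fderiv ℝ φ) := hφ1.continuous_fderiv one_ne_zero
  have hcF : Continuous fun y => frobeniusNormSq (fderiv ℝ Ω y) :=
    continuous_frobeniusNormSq_fderiv_lerayVorticity hV s
  have hccurl : Continuous (curl Ω) := by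
    rw [curl_eq_curlCLM_comp]; exact curlCLM.continuous.comp hcDΩ
  -- move the derivative onto `Ω`
  have hIBP := integral_mul_inner_stretching_eq hφ1 hφc hU1 hΩ1 hdivΩ
  -- the Lamb split of the main term, pointwise
  have hsplit : ∀ y, φ y * ⟪U y, fderiv ℝ Ω y (Ω y)⟫ =
      φ y * ⟪convect U Ω y, Ω y⟫ - φ y * ⟪U y, cross (Ω y) (curl Ω y)⟫ := by
    intro y
    rw [← convect_apply, inner_convect_self_eq_sub Ω U y, mul_sub]
  -- integrability
  have iF : Integrable fun y => φ y * frobeniusNormSq (fderiv ℝ Ω y) :=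
    (hcφ.mul hcF).integrable_of_hasCompactSupport hφc.mul_right
  have iZ : Integrable fun y => φ y * ‖Ω y‖ ^ 2 :=
    (hcφ.mul (hcΩ.norm.pow 2)).integrable_of_hasCompactSupport hφc.mul_right
  have iT : Integrable fun y => φ y * ⟪convect U Ω y, Ω y⟫ := by
    refine (hcφ.mul ?_).integrable_of_hasCompactSupport hφc.mul_right
    simp_rw [convect_apply]
    exact (hcDΩ.clm_apply hcU).inner hcΩ
  have hcL : Continuous fun y => cross (Ω y) (curl Ω y) :=
    (crossCLM.continuous₂.comp (hcΩ.prodMk hccurl)).congr fun _ => rfl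
  have iL : Integrable fun y => φ y * ⟪U y, cross (Ω y) (curl Ω y)⟫ :=
    (hcφ.mul (hcU.inner hcL)).integrable_of_hasCompactSupport hφc.mul_right
  -- (a1) the transport piece: `−∫φ⟪(U·∇)Ω, Ω⟫ = ½∫(U·∇φ)‖Ω‖² ≤ ½C(c₁/R) I`
  have hTr : 2 * (∫ y, φ y * ⟪convect U Ω y, Ω y⟫) = -(∫ y, fderiv ℝ φ y (U y) * ‖Ω y‖ ^ 2) :=
    two_mul_integral_mul_inner_convect_self_eq_of_isDivFree hφ hφc hΩs hUs hdivU
  have hTcollar : |∫ y, fderiv ℝ φ y (U y) * ‖Ω y‖ ^ 2| ≤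
      C * (c₁ / R) * ∫ y in closedBall (0 : EuclideanSpace ℝ (Fin 3)) (2 * R), ‖Ω y‖ ^ 2 := by
    refine abs_integral_le_of_weight_sq hcΩ (w := fun y => C * ‖fderiv ℝ φ y‖)
      (continuous_const.mul hcDφ.norm) (fun y hy => ?_) (fun y _ => ?_) (fun y => ?_)
    · show C * ‖fderiv ℝ φ y‖ = 0
      rw [hφdef, signedBudget_fderiv_cutoff_eq_zero hR hy, norm_zero, mul_zero]
    · show C * ‖fderiv ℝ φ y‖ ≤ C * (c₁ / R)
      exact mul_le_mul_of_nonneg_left (hc₁ R hR y) hC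
    · rw [abs_mul, abs_of_nonneg (sq_nonneg ‖Ω y‖)]
      have e1 : |fderiv ℝ φ y (U y)| ≤ ‖fderiv ℝ φ y‖ * C := by
        rw [← Real.norm_eq_abs]
        exact (ContinuousLinearMap.le_opNorm _ _).trans
          (mul_le_mul_of_nonneg_left (hUC y) (norm_nonneg _))
      calc |fderiv ℝ φ y (U y)| * ‖Ω y‖ ^ 2 ≤ (‖fderiv ℝ φ y‖ * C) * ‖Ω y‖ ^ 2 :=
            mul_le_mul_of_nonneg_right e1 (sq_nonneg _)
        _ = C * ‖fderiv ℝ φ y‖ * ‖Ω y‖ ^ 2 := by ring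
  -- (a2) the Lamb piece: `∫φ⟪U, Ω × curl Ω⟫ ≤ ∫φ|∇Ω|²_F + (θ²/2)∫φ‖Ω‖²`
  have hLamb : (∫ y, φ y * ⟪U y, cross (Ω y) (curl Ω y)⟫) ≤
      (∫ y, φ y * frobeniusNormSq (fderiv ℝ Ω y)) + (θ ^ 2 / 2) * ∫ y, φ y * ‖Ω y‖ ^ 2 := by
    rw [← integral_const_mul, ← integral_add iF (iZ.const_mul _)]
    refine integral_mono iL (iF.add (iZ.const_mul _)) fun y => ?_
    dsimp only
    have h1 : ⟪U y, cross (Ω y) (curl Ω y)⟫ ≤ θ * (‖Ω y‖ * ‖curl Ω y‖) :=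
      inner_lamb_le_of_crossFlow _ _ _ (hX y)
    have h2 := norm_curl_sq_le_two_mul_frobeniusNormSq Ω y
    have h3 : θ * (‖Ω y‖ * ‖curl Ω y‖) ≤
        frobeniusNormSq (fderiv ℝ Ω y) + θ ^ 2 / 2 * ‖Ω y‖ ^ 2 := by
      nlinarith [sq_nonneg (‖curl Ω y‖ - θ * ‖Ω y‖), norm_nonneg (Ω y), norm_nonneg (curl Ω y)]
    have h4 : φ y * ⟪U y, cross (Ω y) (curl Ω y)⟫ ≤
        φ y * (frobeniusNormSq (fderiv ℝ Ω y) + θ ^ 2 / 2 * ‖Ω y‖ ^ 2) :=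
      mul_le_mul_of_nonneg_left (h1.trans h3) (hφ0 y)
    linarith
  -- (b) the collar term `−∫Dφ(Ω)⟪U, Ω⟫ ≤ C(c₁/R) I`
  have hcollar : |∫ y, fderiv ℝ φ y (Ω y) * ⟪U y, Ω y⟫| ≤
      C * (c₁ / R) * ∫ y in closedBall (0 : EuclideanSpace ℝ (Fin 3)) (2 * R), ‖Ω y‖ ^ 2 := by
    refine abs_integral_le_of_weight_sq hcΩ (w := fun y => C * ‖fderiv ℝ φ y‖)
      (continuous_const.mul hcDφ.norm) (fun y hy => ?_) (fun y _ => ?_) (fun y => ?_)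
    · show C * ‖fderiv ℝ φ y‖ = 0
      rw [hφdef, signedBudget_fderiv_cutoff_eq_zero hR hy, norm_zero, mul_zero]
    · show C * ‖fderiv ℝ φ y‖ ≤ C * (c₁ / R)
      exact mul_le_mul_of_nonneg_left (hc₁ R hR y) hC
    · rw [abs_mul]
      have e1 : |fderiv ℝ φ y (Ω y)| ≤ ‖fderiv ℝ φ y‖ * ‖Ω y‖ := by
        rw [← Real.norm_eq_abs]; exact ContinuousLinearMap.le_opNorm _ _
      have e2 : |⟪U y, Ω y⟫| ≤ C * ‖Ω y‖ := by
        rw [← Real.norm_eq_abs]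
        exact (norm_inner_le_norm _ _).trans (mul_le_mul_of_nonneg_right (hUC y) (norm_nonneg _))
      calc |fderiv ℝ φ y (Ω y)| * |⟪U y, Ω y⟫| ≤ (‖fderiv ℝ φ y‖ * ‖Ω y‖) * (C * ‖Ω y‖) :=
            mul_le_mul e1 e2 (abs_nonneg _) (by positivity)
        _ = C * ‖fderiv ℝ φ y‖ * ‖Ω y‖ ^ 2 := by ring
  -- assemble
  have hmain : (∫ y, φ y * ⟪U y, fderiv ℝ Ω y (Ω y)⟫) =
      (∫ y, φ y * ⟪convect U Ω y, Ω y⟫) - ∫ y, φ y * ⟪U y, cross (Ω y) (curl Ω y)⟫ := by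
    rw [← integral_sub iT iL]
    exact integral_congr_ae (Eventually.of_forall hsplit)
  have hT' := (neg_le_abs _).trans hTcollar
  have hT'' := (le_abs_self _).trans hTcollar
  have hcollar' := (neg_le_abs _).trans hcollar
  rw [hIBP, hmain]
  nlinarith [hTr, hT', hT'', hLamb, hcollar', hC]

/-! ### The budget and the Liouville theorem -/

/-- **The localised similarity-enstrophy inequality under the cross-flow hypothesis, NO spatial
hypothesis**: for a KNSS-gauge Type-I field with `‖Ω × U‖ ≤ θ‖Ω‖` at every `(s, y)` there is `L ≥ 0` with
`Z_R' ≤ −½(1 − 2θ²)Z_R + (L/R)∫_{B̄_{2R}}‖Ω‖²` for every `R ≥ 1`, `s` (the tree's identity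
`signedBudget_deriv_cutoffEnstrophy_eq`, the signed drift flux, `two_mul_integral_cutoff_stretching_le_of_crossFlow`,
and the collar bounds; `L = 4Cc₁ + c₂`). [this file] -/
theorem deriv_cutoffEnstrophy_le_of_crossFlow (hV : IsTypeIAncientMild C V) {θ : ℝ}
    (hX : ∀ (s : ℝ) (y : EuclideanSpace ℝ (Fin 3)),
      ‖cross (lerayVorticity V s y) (lerayOrbit V s y)‖ ≤ θ * ‖lerayVorticity V s y‖) :
    ∃ L : ℝ, 0 ≤ L ∧ ∀ R : ℝ, 1 ≤ R → ∀ s : ℝ,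
      deriv (fun σ => ∫ y, smoothTransition (2 - ‖y‖ ^ 2 / R ^ 2) * ‖lerayVorticity V σ y‖ ^ 2) s ≤
        -((1 / 2) * (1 - 2 * θ ^ 2)) *
            (∫ y, smoothTransition (2 - ‖y‖ ^ 2 / R ^ 2) * ‖lerayVorticity V s y‖ ^ 2) +
          L / R * ∫ y in closedBall (0 : EuclideanSpace ℝ (Fin 3)) (2 * R),
            ‖lerayVorticity V s y‖ ^ 2 := by
  obtain ⟨c₁, hc₁0, hc₁⟩ :=
    exists_norm_fderiv_smoothTransition_cutoff_le (E := EuclideanSpace ℝ (Fin 3))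
  obtain ⟨c₂, hc₂0, hc₂⟩ :=
    exists_abs_laplacian_smoothTransition_cutoff_le (E := EuclideanSpace ℝ (Fin 3))
  have hC : 0 ≤ C := hV.nonneg
  refine ⟨4 * C * c₁ + c₂, by positivity, fun R hR1 s => ?_⟩
  have hR : 0 < R := lt_of_lt_of_le one_pos hR1
  rw [signedBudget_deriv_cutoffEnstrophy_eq hV hR s]
  set φ : EuclideanSpace ℝ (Fin 3) → ℝ := fun z => smoothTransition (2 - ‖z‖ ^ 2 / R ^ 2)
    with hφdef
  set Ω := lerayVorticity V s with hΩdef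
  set U := lerayOrbit V s with hUdef
  set I : ℝ := ∫ y in closedBall (0 : EuclideanSpace ℝ (Fin 3)) (2 * R), ‖Ω y‖ ^ 2 with hIdef
  have hI0 : 0 ≤ I := integral_nonneg fun y => sq_nonneg _
  have hφ1 : ContDiff ℝ 1 φ := contDiff_smoothTransition_cutoff (n := 1) R
  have hφ2 : ContDiff ℝ 2 φ := contDiff_smoothTransition_cutoff (n := 2) R
  have hcDφ : Continuous (fderiv ℝ φ) := hφ1.continuous_fderiv one_ne_zero
  have hΩ1 : ContDiff ℝ 1 Ω := signedBudget_contDiff_lerayVorticity_slice hV s (n := 1)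
  have hcΩ : Continuous Ω := hΩ1.continuous
  have hUC : ∀ y, ‖U y‖ ≤ C := fun y => norm_lerayOrbit_le_of_typeI hV s y
  -- (1) drift flux `≤ 0`
  have hD : (∫ y, fderiv ℝ φ y y * ‖Ω y‖ ^ 2) ≤ 0 := signedBudget_drift_flux_nonpos V R s
  -- (2) transport flux
  have hT : |∫ y, fderiv ℝ φ y (U y) * ‖Ω y‖ ^ 2| ≤ C * (c₁ / R) * I := by
    refine abs_integral_le_of_weight_sq hcΩ (w := fun y => C * ‖fderiv ℝ φ y‖)
      (continuous_const.mul hcDφ.norm) (fun y hy => ?_) (fun y _ => ?_) (fun y => ?_)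
    · show C * ‖fderiv ℝ φ y‖ = 0
      rw [hφdef, signedBudget_fderiv_cutoff_eq_zero hR hy, norm_zero, mul_zero]
    · show C * ‖fderiv ℝ φ y‖ ≤ C * (c₁ / R)
      exact mul_le_mul_of_nonneg_left (hc₁ R hR y) hC
    · rw [abs_mul, abs_of_nonneg (sq_nonneg ‖Ω y‖)]
      have e1 : |fderiv ℝ φ y (U y)| ≤ ‖fderiv ℝ φ y‖ * C := by
        rw [← Real.norm_eq_abs]
        exact (ContinuousLinearMap.le_opNorm _ _).trans
          (mul_le_mul_of_nonneg_left (hUC y) (norm_nonneg _))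
      calc |fderiv ℝ φ y (U y)| * ‖Ω y‖ ^ 2 ≤ (‖fderiv ℝ φ y‖ * C) * ‖Ω y‖ ^ 2 :=
            mul_le_mul_of_nonneg_right e1 (sq_nonneg _)
        _ = C * ‖fderiv ℝ φ y‖ * ‖Ω y‖ ^ 2 := by ring
  -- (3) viscous flux
  have hVisc : |∫ y, ‖Ω y‖ ^ 2 * (Δ φ) y| ≤ (c₂ / R ^ 2) * I := by
    refine abs_integral_le_of_weight_sq hcΩ (w := fun y => |(Δ φ) y|)
      (continuous_laplacian hφ2).abs (fun y hy => ?_) (fun y _ => hc₂ R hR y) (fun y => ?_)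
    · show |(Δ φ) y| = 0
      rw [hφdef, signedBudget_laplacian_cutoff_eq_zero hR hy, abs_zero]
    · rw [abs_mul, abs_of_nonneg (sq_nonneg ‖Ω y‖), mul_comm]
  have hR2 : c₂ / R ^ 2 ≤ c₂ / R := by
    rw [div_le_div_iff₀ (by positivity) hR]
    have : R ≤ R ^ 2 := by nlinarith
    exact mul_le_mul_of_nonneg_left this hc₂0
  -- (4) stretching
  have hS := two_mul_integral_cutoff_stretching_le_of_crossFlow hV hc₁ (hX s) hR
  -- assemble
  have hT' := (le_abs_self _).trans hT
  have hVisc' := ((le_abs_self _).trans hVisc).trans (mul_le_mul_of_nonneg_right hR2 hI0)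
  have e : (4 * C * c₁ + c₂) / R * I = C * (c₁ / R) * I + 3 * C * (c₁ / R) * I + c₂ / R * I := by
    ring
  rw [e]
  nlinarith [hD, hT', hVisc', hS]

/-- **The CROSS-FLOW threshold WITHOUT the envelope, CLASSICAL, similarity variables.** A Type-I ancient
mild solution in the KNSS gauge (`IsTypeIAncientMild C V`, ANY `C`, NO spatial hypothesis) whose Leray orbit
satisfies `‖Ω(s,y) × U(s,y)‖ ≤ θ‖Ω(s,y)‖` for all `s, y` with `2θ² < 1` vanishes on `t < 0`: the budget
`deriv_cutoffEnstrophy_le_of_crossFlow` with rate `½(1 − 2θ²) > 0`, the bootstrap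
`cutoffEnstrophy_eq_zero_of_budget`, and the endgame `eq_zero_of_cutoffEnstrophy_eq_zero`. [this file] -/
theorem typeI_ancient_eq_zero_of_crossFlow_noDecay_sim (hV : IsTypeIAncientMild C V) {θ : ℝ}
    (hθ : 2 * θ ^ 2 < 1)
    (hX : ∀ (s : ℝ) (y : EuclideanSpace ℝ (Fin 3)),
      ‖cross (lerayVorticity V s y) (lerayOrbit V s y)‖ ≤ θ * ‖lerayVorticity V s y‖) :
    ∀ t < 0, ∀ x, V t x = 0 := by
  obtain ⟨L, hL, hbudget⟩ := deriv_cutoffEnstrophy_le_of_crossFlow hV hX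
  have hκ : 0 < (1 / 2 : ℝ) * (1 - 2 * θ ^ 2) := by nlinarith
  refine eq_zero_of_cutoffEnstrophy_eq_zero hV
    (cutoffEnstrophy_eq_zero_of_budget hV hκ hL fun R hR s => ?_)
  have h := hbudget R hR s
  linarith

/-- **The CROSS-FLOW threshold WITHOUT the envelope, CLASSICAL, physical variables, UNCONDITIONAL** (no (D),
no `HasTypeIDecay`, ANY Type-I constant `C`). A Type-I ancient mild solution in the KNSS gauge such that, at
every `t < 0` and `x`, `√(−t)·‖ω(t,x) × V(t,x)‖ ≤ θ‖ω(t,x)‖` (`ω = curl V(t)`: the velocity component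
across the vorticity is at most `θ/√(−t)` on the vortex set) with `2θ² < 1` (`|θ| < 1/√2`), vanishes on
`t < 0`. Scale covariance (`U = λV`, `Ω = λ²ω`, `λ = √(−t)`) reduces to
`typeI_ancient_eq_zero_of_crossFlow_noDecay_sim`. Compare `typeI_ancient_eq_zero_of_crossFlow_lt_one`
(threshold `1`, but WITH the envelope `HasTypeIDecay C₀ V`) and T31⁗ `typeI_ancient_eq_zero_of_rate_lt_one`
(`‖V‖` in place of the cross-flow, threshold `1`). [this file; conditional statement — nothing asserts the
hypothesis for a given field; nothing here bears on NS regularity] -/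
theorem typeI_ancient_eq_zero_of_crossFlow_noDecay (hV : IsTypeIAncientMild C V) {θ : ℝ}
    (hθ : 2 * θ ^ 2 < 1)
    (hX : ∀ t < 0, ∀ x,
      Real.sqrt (-t) * ‖cross (curl (V t) x) (V t x)‖ ≤ θ * ‖curl (V t) x‖) :
    ∀ t < 0, ∀ x, V t x = 0 := by
  refine typeI_ancient_eq_zero_of_crossFlow_noDecay_sim hV hθ fun s y => ?_
  have hl0 : 0 < Real.exp (-s / 2) := Real.exp_pos _
  have hk0 : 0 < Real.exp (-s) := Real.exp_pos _
  have ht0 : -Real.exp (-s) < 0 := neg_neg_of_pos hk0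
  have hU : lerayOrbit V s y =
      Real.exp (-s / 2) • V (-Real.exp (-s)) (Real.exp (-s / 2) • y) := by
    rw [lerayOrbit_apply]
  have hΩ : lerayVorticity V s y =
      Real.exp (-s) • curl (V (-Real.exp (-s))) (Real.exp (-s / 2) • y) := by
    rw [lerayVorticity_apply, curl_lerayOrbit]
  have h := hX _ ht0 (Real.exp (-s / 2) • y)
  rw [neg_neg, sqrt_exp_neg] at h
  set N : ℝ := ‖cross (curl (V (-Real.exp (-s))) (Real.exp (-s / 2) • y))
      (V (-Real.exp (-s)) (Real.exp (-s / 2) • y))‖ with hN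
  set B : ℝ := ‖curl (V (-Real.exp (-s))) (Real.exp (-s / 2) • y)‖ with hB
  have eL : ‖cross (lerayVorticity V s y) (lerayOrbit V s y)‖ =
      Real.exp (-s) * (Real.exp (-s / 2) * N) := by
    rw [hU, hΩ, cross_smul_left, cross_smul_right, norm_smul, norm_smul,
      Real.norm_of_nonneg hk0.le, Real.norm_of_nonneg hl0.le]
  have eR : ‖lerayVorticity V s y‖ = Real.exp (-s) * B := by
    rw [hΩ, norm_smul, Real.norm_of_nonneg hk0.le]
  rw [eL, eR]
  calc Real.exp (-s) * (Real.exp (-s / 2) * N)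
      ≤ Real.exp (-s) * (θ * B) := mul_le_mul_of_nonneg_left h hk0.le
    _ = θ * (Real.exp (-s) * B) := by ring

end Summit.NavierStokesRegularity.NavierStokesRegularity.Theorems.SimilarityEnstrophy

end
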